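import Summits.QuantumFields.YangMills.Theses.PencilRigidity

/-!
# `HypercubicLimit` — negative-side support: the non-triviality clause in real and in lattice terms;
# non-abelianness of `G` is load-bearing

Support file for crux `stmt-QuantumFields-8646` (`HypercubicLimit`), extracted from the standing disprover's
work file `Cruxes/HypercubicLimit/Disproof.lean` §3.  Tree objects only, nothing posited.  The crux's
non-triviality clause (for the label `s`, = `OSData.IsNontrivial` unbundled) and its convergence clause are
written out verbatim in every statement.

* `not_twoPointNontrivial_of_factorizes` (**bridge real → complex**): if `𝔖₂` factorises on every real
  tensor `u ⊗ v` with `supp u ⊆ {t<0}`, `supp v ⊆ {t>0}` then the complex, time-ordered clause fails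
  (decompose `θF̄₁ ⊗ G₁` into four such real tensors, all in `⁰𝒮`).
* `twoPointNontrivial_of_real`, `twoPointNontrivial_iff_real`: conversely one real pair with a non-vanishing
  truncated two-point value certifies the clause; so the clause ⇔ ONE real truncated value
  `𝔖₂(u ⊗ v) ≠ 𝔖₁(u)𝔖₁(v)` at separated half-spaces.
(Lattice form and the trivial-group application: `Negative/NonabelianLoadBearing.lean`.) [folklore]
-/

noncomputable section

open scoped SchwartzMap ComplexConjugate
open MeasureTheory Filter Topology Complex
open Literature.MathematicalPhysics.AQFT Literature.MathematicalPhysics.QuantumLattice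
open Literature.MathematicalPhysics.QuantumFieldTheory

namespace Summit.QuantumFields.YangMills.Theorems.HypercubicLimit.Negative


section Bridge

variable {ι : Type}

/-- Real part of a complex test function on `ℝ⁴`. [folklore] -/
def reTest (F : 𝓢((EuclideanSpace ℝ (Fin 4)), ℂ)) : 𝓢((EuclideanSpace ℝ (Fin 4)), ℝ) := SchwartzMap.postcompCLM (𝕜 := ℝ) Complex.reCLM F

/-- Imaginary part of a complex test function on `ℝ⁴`. [folklore] -/
def imTest (F : 𝓢((EuclideanSpace ℝ (Fin 4)), ℂ)) : 𝓢((EuclideanSpace ℝ (Fin 4)), ℝ) := SchwartzMap.postcompCLM (𝕜 := ℝ) Complex.imCLM F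

/-- `reTest_apply` (auxiliary, see the module docstring). [folklore] -/
@[simp] theorem reTest_apply (F : 𝓢((EuclideanSpace ℝ (Fin 4)), ℂ)) (x : (EuclideanSpace ℝ (Fin 4))) : reTest F x = (F x).re := rfl

/-- `imTest_apply` (auxiliary, see the module docstring). [folklore] -/
@[simp] theorem imTest_apply (F : 𝓢((EuclideanSpace ℝ (Fin 4)), ℂ)) (x : (EuclideanSpace ℝ (Fin 4))) : imTest F x = (F x).im := rfl

/-- The one-variable function `y ↦ conj F₁(θy)` behind `osAdjoint F₁` for a one-point `F₁`. [folklore] -/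
def adjOne (F₁ : 𝓢((Fin 1 → (EuclideanSpace ℝ (Fin 4))), ℂ)) : 𝓢((EuclideanSpace ℝ (Fin 4)), ℂ) :=
  starTest (SchwartzMap.compCLMOfContinuousLinearEquiv ℂ
    ((timeReflection 4).toContinuousLinearEquiv.trans
      (ContinuousLinearEquiv.funUnique (Fin 1) ℝ (EuclideanSpace ℝ (Fin 4))).symm) F₁)

/-- `adjOne_apply` (auxiliary, see the module docstring). [folklore] -/
theorem adjOne_apply (F₁ : 𝓢((Fin 1 → (EuclideanSpace ℝ (Fin 4))), ℂ)) (y : (EuclideanSpace ℝ (Fin 4))) :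
    adjOne F₁ y = conj (F₁ (fun _ => timeReflection 4 y)) := by
  simp only [adjOne, starTest_apply, SchwartzMap.compCLMOfContinuousLinearEquiv_apply,
    Function.comp_apply, ContinuousLinearEquiv.trans_apply,
    ContinuousLinearEquiv.coe_funUnique_symm]
  rfl

/-- The one-variable function `y ↦ G₁(y)` of a one-point `G₁`. [folklore] -/
def oneVar (G₁ : 𝓢((Fin 1 → (EuclideanSpace ℝ (Fin 4))), ℂ)) : 𝓢((EuclideanSpace ℝ (Fin 4)), ℂ) :=
  SchwartzMap.compCLMOfContinuousLinearEquiv ℂ (ContinuousLinearEquiv.funUnique (Fin 1) ℝ (EuclideanSpace ℝ (Fin 4))).symm G₁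

/-- `oneVar_apply` (auxiliary, see the module docstring). [folklore] -/
theorem oneVar_apply (G₁ : 𝓢((Fin 1 → (EuclideanSpace ℝ (Fin 4))), ℂ)) (y : (EuclideanSpace ℝ (Fin 4))) : oneVar G₁ y = G₁ (fun _ => y) := by
  simp only [oneVar, SchwartzMap.compCLMOfContinuousLinearEquiv_apply, Function.comp_apply,
    ContinuousLinearEquiv.coe_funUnique_symm]
  rfl

/-- `eq_const_of_fin_one` (auxiliary, see the module docstring). [folklore] -/
theorem eq_const_of_fin_one (x : Fin 1 → (EuclideanSpace ℝ (Fin 4))) : x = fun _ => x 0 := by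
  funext i; rw [Subsingleton.elim i 0]

/-- `osAdjoint_one_apply` (auxiliary, see the module docstring). [folklore] -/
theorem osAdjoint_one_apply (F₁ : 𝓢((Fin 1 → (EuclideanSpace ℝ (Fin 4))), ℂ)) (x : Fin 1 → (EuclideanSpace ℝ (Fin 4))) :
    osAdjoint F₁ x = adjOne F₁ (x 0) := by
  rw [osAdjoint_apply, adjOne_apply]
  congr 2
  funext i
  rw [Subsingleton.elim (Fin.rev i) 0]

/-- `one_apply_eq_oneVar` (auxiliary, see the module docstring). [folklore] -/
theorem one_apply_eq_oneVar (G₁ : 𝓢((Fin 1 → (EuclideanSpace ℝ (Fin 4))), ℂ)) (x : Fin 1 → (EuclideanSpace ℝ (Fin 4))) :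
    G₁ x = oneVar G₁ (x 0) := by
  rw [oneVar_apply]
  exact congrArg G₁ (eq_const_of_fin_one x)

/-- Support of `y ↦ conj F₁(θy)`: strictly negative times (closed half-space control). [folklore] -/
theorem tsupport_adjOne_subset {F₁ : 𝓢((Fin 1 → (EuclideanSpace ℝ (Fin 4))), ℂ)} (hF₁ : IsTimeOrdered F₁)
    (w : 𝓢((EuclideanSpace ℝ (Fin 4)), ℝ)) (hw : Function.support w ⊆ Function.support (adjOne F₁)) :
    tsupport w ⊆ {y : (EuclideanSpace ℝ (Fin 4)) | y 0 < 0} := by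
  set K : Set (EuclideanSpace ℝ (Fin 4)) := (fun y : (EuclideanSpace ℝ (Fin 4)) => fun _ : Fin 1 => timeReflection 4 y) ⁻¹'
    tsupport (F₁ : (Fin 1 → (EuclideanSpace ℝ (Fin 4))) → ℂ) with hK
  have hKc : IsClosed K :=
    (isClosed_tsupport _).preimage (continuous_pi fun _ => (timeReflection 4).continuous)
  have hsub : Function.support w ⊆ K := by
    intro y hy
    have h1 := hw hy
    rw [Function.mem_support, adjOne_apply, map_ne_zero] at h1
    exact subset_tsupport _ (Function.mem_support.2 h1)
  refine (closure_minimal hsub hKc).trans fun y hy => ?_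
  have h := (hF₁ hy).1 0
  simp only [timeReflection_apply] at h
  simpa using h

/-- Support of `y ↦ G₁(y)`: strictly positive times. [folklore] -/
theorem tsupport_oneVar_subset {G₁ : 𝓢((Fin 1 → (EuclideanSpace ℝ (Fin 4))), ℂ)} (hG₁ : IsTimeOrdered G₁)
    (w : 𝓢((EuclideanSpace ℝ (Fin 4)), ℝ)) (hw : Function.support w ⊆ Function.support (oneVar G₁)) :
    tsupport w ⊆ {y : (EuclideanSpace ℝ (Fin 4)) | 0 < y 0} := by
  set K : Set (EuclideanSpace ℝ (Fin 4)) := (fun y : (EuclideanSpace ℝ (Fin 4)) => fun _ : Fin 1 => y) ⁻¹' tsupport (G₁ : (Fin 1 → (EuclideanSpace ℝ (Fin 4))) → ℂ)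
  have hKc : IsClosed K := (isClosed_tsupport _).preimage (continuous_pi fun _ => continuous_id)
  have hsub : Function.support w ⊆ K := by
    intro y hy
    have h1 := hw hy
    rw [Function.mem_support, oneVar_apply] at h1
    exact subset_tsupport _ (Function.mem_support.2 h1)
  refine (closure_minimal hsub hKc).trans fun y hy => ?_
  exact (hG₁ hy).1 0

/-- `support_reTest_subset` (auxiliary, see the module docstring). [folklore] -/
theorem support_reTest_subset (F : 𝓢((EuclideanSpace ℝ (Fin 4)), ℂ)) :
    Function.support (reTest F) ⊆ Function.support F := by
  intro y hy h
  exact hy (by simp [h])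

/-- `support_imTest_subset` (auxiliary, see the module docstring). [folklore] -/
theorem support_imTest_subset (F : 𝓢((EuclideanSpace ℝ (Fin 4)), ℂ)) :
    Function.support (imTest F) ⊆ Function.support F := by
  intro y hy h
  exact hy (by simp [h])

/-- A real two-tensor `u ⊗ v` with `u` supported in negative and `v` in positive times is in `⁰𝒮`. [folklore] -/
theorem isOffDiagonal_of_halfSpaces {u v : 𝓢((EuclideanSpace ℝ (Fin 4)), ℝ)} (hu : tsupport u ⊆ {y : (EuclideanSpace ℝ (Fin 4)) | y 0 < 0})
    (hv : tsupport v ⊆ {y : (EuclideanSpace ℝ (Fin 4)) | 0 < y 0}) {T : 𝓢((Fin (1 + 1) → (EuclideanSpace ℝ (Fin 4))), ℂ)}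
    (hT : IsTensorOf T (fun i => ofRealTest (![u, v] i))) : IsOffDiagonal T := by
  apply IsOffDiagonal.of_tsupport_subset
  set K : Set (Fin (1 + 1) → (EuclideanSpace ℝ (Fin 4))) := {x | x 0 ∈ tsupport u ∧ x 1 ∈ tsupport v}
  have hKc : IsClosed K :=
    ((isClosed_tsupport _).preimage (continuous_apply 0)).inter
      ((isClosed_tsupport _).preimage (continuous_apply 1))
  have hsub : Function.support (T : (Fin (1 + 1) → (EuclideanSpace ℝ (Fin 4))) → ℂ) ⊆ K := by
    intro x hx
    rw [Function.mem_support, hT x] at hx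
    simp only [Fin.prod_univ_succ, Fin.prod_univ_zero, Matrix.cons_val_zero, Matrix.cons_val_succ,
      ofRealTest_apply, mul_one] at hx
    refine ⟨subset_tsupport _ ?_, subset_tsupport _ ?_⟩
    · intro h; apply hx; simp [h]
    · intro h; apply hx; simp [h]
  refine (closure_minimal hsub hKc).trans ?_
  rintro x ⟨hx0, hx1⟩ ⟨i, j, hij, hxij⟩
  have h0 := hu hx0
  have h1 := hv hx1
  simp only [Set.mem_setOf_eq] at h0 h1
  fin_cases i <;> fin_cases j
  · exact hij rfl
  · simp at hxij; rw [hxij] at h0; linarith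
  · simp at hxij; rw [hxij] at h1; linarith
  · exact hij rfl

/-- Real one-point tensor `x ↦ w(x 0)`. [folklore] -/
def tensor₁ (w : 𝓢((EuclideanSpace ℝ (Fin 4)), ℝ)) : 𝓢((Fin 1 → (EuclideanSpace ℝ (Fin 4))), ℂ) :=
  SchwartzMap.tensorFin 1 (fun i => ofRealTest (![w] i))

/-- Real two-point tensor `x ↦ u(x 0) v(x 1)`. [folklore] -/
def tensor₂ (u v : 𝓢((EuclideanSpace ℝ (Fin 4)), ℝ)) : 𝓢((Fin (1 + 1) → (EuclideanSpace ℝ (Fin 4))), ℂ) :=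
  SchwartzMap.tensorFin (1 + 1) (fun i => ofRealTest (![u, v] i))

/-- `isTensorOf_tensor₁` (auxiliary, see the module docstring). [folklore] -/
theorem isTensorOf_tensor₁ (w : 𝓢((EuclideanSpace ℝ (Fin 4)), ℝ)) : IsTensorOf (tensor₁ w) (fun i => ofRealTest (![w] i)) :=
  isTensorOf_tensorFin _

/-- `isTensorOf_tensor₂` (auxiliary, see the module docstring). [folklore] -/
theorem isTensorOf_tensor₂ (u v : 𝓢((EuclideanSpace ℝ (Fin 4)), ℝ)) :
    IsTensorOf (tensor₂ u v) (fun i => ofRealTest (![u, v] i)) :=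
  isTensorOf_tensorFin _

/-- `tensor₁_apply` (auxiliary, see the module docstring). [folklore] -/
@[simp] theorem tensor₁_apply (w : 𝓢((EuclideanSpace ℝ (Fin 4)), ℝ)) (x : Fin 1 → (EuclideanSpace ℝ (Fin 4))) : tensor₁ w x = (w (x 0) : ℂ) := by
  rw [isTensorOf_tensor₁ w x]
  simp

/-- `tensor₂_apply` (auxiliary, see the module docstring). [folklore] -/
@[simp] theorem tensor₂_apply (u v : 𝓢((EuclideanSpace ℝ (Fin 4)), ℝ)) (x : Fin (1 + 1) → (EuclideanSpace ℝ (Fin 4))) :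
    tensor₂ u v x = (u (x 0) : ℂ) * (v (x 1) : ℂ) := by
  rw [isTensorOf_tensor₂ u v x]
  simp [Fin.prod_univ_succ]

/-- **Bridge (real tensors ⇒ complex clause).** If the two-point function of the species `s`
factorises on every REAL off-diagonal tensor `u ⊗ v` into the product of the one-point values,
then the (complex, time-ordered) non-triviality clause of the crux fails for `s`.  This is the
form in which the convergence clause (which only speaks about real tensors) controls
`TwoPointNontrivial`. [folklore] -/
theorem not_twoPointNontrivial_of_factorizes (S : LabelledSchwingerFamily ι (EuclideanSpace ℝ (Fin 4))) (s : ι)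
    (hfac : ∀ (u v : 𝓢((EuclideanSpace ℝ (Fin 4)), ℝ)), tsupport u ⊆ {y : (EuclideanSpace ℝ (Fin 4)) | y 0 < 0} → tsupport v ⊆ {y : (EuclideanSpace ℝ (Fin 4)) | 0 < y 0} →
      S (1 + 1) (fun _ => s) (tensor₂ u v) = S 1 (fun _ => s) (tensor₁ u) * S 1 (fun _ => s) (tensor₁ v)) :
    ¬ (∃ (F₁ G₁ : 𝓢((Fin 1 → (EuclideanSpace ℝ (Fin 4))), ℂ)) (H₁ : 𝓢((Fin (1 + 1) → (EuclideanSpace ℝ (Fin 4))), ℂ)),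
      IsTimeOrdered F₁ ∧ IsTimeOrdered G₁ ∧ IsAppendTensorOf H₁ (osAdjoint F₁) G₁ ∧
        S (1 + 1) (fun _ => s) H₁ ≠ S 1 (fun _ => s) (osAdjoint F₁) * S 1 (fun _ => s) G₁) := by
  rintro ⟨F₁, G₁, H₁, hF₁, hG₁, hH₁, hne⟩
  apply hne
  set ur := reTest (adjOne F₁)
  set ui := imTest (adjOne F₁)
  set vr := reTest (oneVar G₁)
  set vi := imTest (oneVar G₁)
  have hur : tsupport ur ⊆ {y : (EuclideanSpace ℝ (Fin 4)) | y 0 < 0} := tsupport_adjOne_subset hF₁ _ (support_reTest_subset _)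
  have hui : tsupport ui ⊆ {y : (EuclideanSpace ℝ (Fin 4)) | y 0 < 0} := tsupport_adjOne_subset hF₁ _ (support_imTest_subset _)
  have hvr : tsupport vr ⊆ {y : (EuclideanSpace ℝ (Fin 4)) | 0 < y 0} := tsupport_oneVar_subset hG₁ _ (support_reTest_subset _)
  have hvi : tsupport vi ⊆ {y : (EuclideanSpace ℝ (Fin 4)) | 0 < y 0} := tsupport_oneVar_subset hG₁ _ (support_imTest_subset _)
  -- pointwise decompositions
  have hH : ∀ x, H₁ x = adjOne F₁ (x 0) * oneVar G₁ (x 1) := by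
    intro x
    rw [hH₁ x, osAdjoint_one_apply, one_apply_eq_oneVar]
    rfl
  have hdecH : H₁ = tensor₂ ur vr + (I : ℂ) • tensor₂ ur vi + (I : ℂ) • tensor₂ ui vr - tensor₂ ui vi := by
    ext x
    simp only [sub_apply, add_apply, smul_apply, smul_eq_mul,
      tensor₂_apply, hH x, ur, ui, vr, vi, reTest_apply, imTest_apply]
    apply Complex.ext <;> simp
  have hdecF : osAdjoint F₁ = tensor₁ ur + (I : ℂ) • tensor₁ ui := by
    ext x
    simp only [add_apply, smul_apply, smul_eq_mul, tensor₁_apply,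
      osAdjoint_one_apply, ur, ui, reTest_apply, imTest_apply]
    apply Complex.ext <;> simp
  have hdecG : G₁ = tensor₁ vr + (I : ℂ) • tensor₁ vi := by
    ext x
    simp only [add_apply, smul_apply, smul_eq_mul, tensor₁_apply,
      one_apply_eq_oneVar G₁ x, vr, vi, reTest_apply, imTest_apply]
    apply Complex.ext <;> simp
  have lhs : S (1 + 1) (fun _ => s) H₁ =
      S 1 (fun _ => s) (tensor₁ ur) * S 1 (fun _ => s) (tensor₁ vr) +
      I * (S 1 (fun _ => s) (tensor₁ ur) * S 1 (fun _ => s) (tensor₁ vi)) +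
      I * (S 1 (fun _ => s) (tensor₁ ui) * S 1 (fun _ => s) (tensor₁ vr)) -
      S 1 (fun _ => s) (tensor₁ ui) * S 1 (fun _ => s) (tensor₁ vi) := by
    rw [hdecH, map_sub, map_add, map_add, map_smul, map_smul, smul_eq_mul, smul_eq_mul,
      hfac _ _ hur hvr, hfac _ _ hur hvi, hfac _ _ hui hvr, hfac _ _ hui hvi]
  have rhs : S 1 (fun _ => s) (osAdjoint F₁) * S 1 (fun _ => s) G₁ =
      (S 1 (fun _ => s) (tensor₁ ur) + I * S 1 (fun _ => s) (tensor₁ ui)) *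
      (S 1 (fun _ => s) (tensor₁ vr) + I * S 1 (fun _ => s) (tensor₁ vi)) := by
    rw [hdecF, hdecG, map_add, map_add, map_smul, map_smul, smul_eq_mul, smul_eq_mul]
  rw [lhs, rhs]
  linear_combination (-(S 1 (fun _ => s) (tensor₁ ui) * S 1 (fun _ => s) (tensor₁ vi))) * I_mul_I

/-! ### The converse: real positive-time witnesses certify `TwoPointNontrivial` -/

/-- The one-point test function `x ↦ u(θ x₀)` whose OS adjoint is `tensor₁ u`. [folklore] -/
def thetaTensor₁ (u : 𝓢((EuclideanSpace ℝ (Fin 4)), ℝ)) : 𝓢((Fin 1 → (EuclideanSpace ℝ (Fin 4))), ℂ) := tensor₁ (thetaTest 4 u)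

/-- `thetaTensor₁_apply` (auxiliary, see the module docstring). [folklore] -/
@[simp] theorem thetaTensor₁_apply (u : 𝓢((EuclideanSpace ℝ (Fin 4)), ℝ)) (x : Fin 1 → (EuclideanSpace ℝ (Fin 4))) :
    thetaTensor₁ u x = (u (timeReflection 4 (x 0)) : ℂ) := by
  simp [thetaTensor₁]

/-- `osAdjoint_thetaTensor₁` (auxiliary, see the module docstring). [folklore] -/
theorem osAdjoint_thetaTensor₁ (u : 𝓢((EuclideanSpace ℝ (Fin 4)), ℝ)) : osAdjoint (thetaTensor₁ u) = tensor₁ u := by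
  ext x
  rw [osAdjoint_apply, thetaTensor₁_apply, tensor₁_apply, Complex.conj_ofReal]
  rw [Subsingleton.elim (Fin.rev (0 : Fin 1)) 0, timeReflection_timeReflection]

/-- A real one-point tensor supported in positive times is time-ordered. [folklore] -/
theorem isTimeOrdered_tensor₁ {v : 𝓢((EuclideanSpace ℝ (Fin 4)), ℝ)} (hv : tsupport v ⊆ {y : (EuclideanSpace ℝ (Fin 4)) | 0 < y 0}) :
    IsTimeOrdered (tensor₁ v) := by
  intro x hx
  have hK : IsClosed ((fun x : Fin 1 → (EuclideanSpace ℝ (Fin 4)) => x 0) ⁻¹' tsupport v) :=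
    (isClosed_tsupport _).preimage (continuous_apply 0)
  have hsub : Function.support (tensor₁ v : (Fin 1 → (EuclideanSpace ℝ (Fin 4))) → ℂ) ⊆ (fun x : Fin 1 → (EuclideanSpace ℝ (Fin 4)) => x 0) ⁻¹' tsupport v := by
    intro y hy
    rw [Function.mem_support, tensor₁_apply, Complex.ofReal_ne_zero] at hy
    exact subset_tsupport _ (Function.mem_support.2 hy)
  have h0 : 0 < x 0 0 := hv (closure_minimal hsub hK hx)
  refine ⟨fun i => by rw [Subsingleton.elim i 0]; exact h0, fun i j hij => ?_⟩
  exact absurd (Subsingleton.elim i j) (ne_of_lt hij)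

/-- `x ↦ u(θx₀)` with `u` supported in negative times is time-ordered. [folklore] -/
theorem isTimeOrdered_thetaTensor₁ {u : 𝓢((EuclideanSpace ℝ (Fin 4)), ℝ)} (hu : tsupport u ⊆ {y : (EuclideanSpace ℝ (Fin 4)) | y 0 < 0}) :
    IsTimeOrdered (thetaTensor₁ u) := by
  apply isTimeOrdered_tensor₁
  have hK : IsClosed ((timeReflection 4) ⁻¹' tsupport u) :=
    (isClosed_tsupport _).preimage (timeReflection 4).continuous
  have hsub : Function.support (thetaTest 4 u) ⊆ (timeReflection 4) ⁻¹' tsupport u := by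
    intro y hy
    rw [Function.mem_support, thetaTest_apply] at hy
    exact subset_tsupport _ (Function.mem_support.2 hy)
  refine (closure_minimal hsub hK).trans fun y hy => ?_
  have h := hu hy
  simp only [Set.mem_setOf_eq, timeReflection_apply] at h
  simpa using h

/-- **Real certificate of non-triviality**: a real pair `u` (negative times), `v` (positive
times) on which the truncated two-point function does not vanish witnesses the crux's complex,
time-ordered clause (`F₁ = u ∘ θ`, `G₁ = v`, `H₁ = θF̄₁ ⊗ G₁ = u ⊗ v`). [folklore] -/
theorem twoPointNontrivial_of_real (S : LabelledSchwingerFamily ι (EuclideanSpace ℝ (Fin 4))) (s : ι) {u v : 𝓢((EuclideanSpace ℝ (Fin 4)), ℝ)}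
    (hu : tsupport u ⊆ {y : (EuclideanSpace ℝ (Fin 4)) | y 0 < 0}) (hv : tsupport v ⊆ {y : (EuclideanSpace ℝ (Fin 4)) | 0 < y 0})
    (hne : S (1 + 1) (fun _ => s) (tensor₂ u v) ≠ S 1 (fun _ => s) (tensor₁ u) * S 1 (fun _ => s) (tensor₁ v)) :
    (∃ (F₁ G₁ : 𝓢((Fin 1 → (EuclideanSpace ℝ (Fin 4))), ℂ)) (H₁ : 𝓢((Fin (1 + 1) → (EuclideanSpace ℝ (Fin 4))), ℂ)),
      IsTimeOrdered F₁ ∧ IsTimeOrdered G₁ ∧ IsAppendTensorOf H₁ (osAdjoint F₁) G₁ ∧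
        S (1 + 1) (fun _ => s) H₁ ≠ S 1 (fun _ => s) (osAdjoint F₁) * S 1 (fun _ => s) G₁) := by
  refine ⟨thetaTensor₁ u, tensor₁ v, tensor₂ u v, isTimeOrdered_thetaTensor₁ hu,
    isTimeOrdered_tensor₁ hv, fun x => ?_, ?_⟩
  · rw [osAdjoint_thetaTensor₁, tensor₂_apply, tensor₁_apply, tensor₁_apply]
    rfl
  · rwa [osAdjoint_thetaTensor₁]


/-- **`TwoPointNontrivial` ⇔ one REAL truncated two-point value at separated half-spaces is
non-zero.**  This is the exact form in which the crux's non-triviality clause must be verified. [folklore] -/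
theorem twoPointNontrivial_iff_real (S : LabelledSchwingerFamily ι (EuclideanSpace ℝ (Fin 4))) (s : ι) :
    (∃ (F₁ G₁ : 𝓢((Fin 1 → (EuclideanSpace ℝ (Fin 4))), ℂ)) (H₁ : 𝓢((Fin (1 + 1) → (EuclideanSpace ℝ (Fin 4))), ℂ)),
      IsTimeOrdered F₁ ∧ IsTimeOrdered G₁ ∧ IsAppendTensorOf H₁ (osAdjoint F₁) G₁ ∧
        S (1 + 1) (fun _ => s) H₁ ≠ S 1 (fun _ => s) (osAdjoint F₁) * S 1 (fun _ => s) G₁) ↔ ∃ u v : 𝓢((EuclideanSpace ℝ (Fin 4)), ℝ), tsupport u ⊆ {y : (EuclideanSpace ℝ (Fin 4)) | y 0 < 0} ∧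
      tsupport v ⊆ {y : (EuclideanSpace ℝ (Fin 4)) | 0 < y 0} ∧
      S (1 + 1) (fun _ => s) (tensor₂ u v) ≠ S 1 (fun _ => s) (tensor₁ u) * S 1 (fun _ => s) (tensor₁ v) := by
  constructor
  · intro h
    by_contra hall
    push Not at hall
    exact not_twoPointNontrivial_of_factorizes S s (fun u v hu hv => hall u v hu hv) h
  · rintro ⟨u, v, hu, hv, hne⟩
    exact twoPointNontrivial_of_real S s hu hv hne

end Bridge

end Summit.QuantumFields.YangMills.Theorems.HypercubicLimit.Negative
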